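import Summits.Ventures.Crystal3D.Theorems.StickyWulffConstantTextureLiminfTexShadowCertificateDefs
import HarnessLib

/-!
# TexShadow §2 — the skeleton-local hypothesis `BarlowAdhesionR`, VERBATIM tree copy
# (lane T, crux `TextureLiminfV5`, stmt-Ventures-23912; cf-p1 DECISION (cxiii) «…TexShadowAdhesionDefs GO», 2026-08-29T05:13:29Z)

HONEST FRAMING. Venture `Summits/Ventures/Crystal3D` (cell `crystal3d-full`), route `route-Ventures-StickyWulffConstant`, helper `--supports` the law-v5
crux `TextureLiminfV5` (stmt-Ventures-23912).  DEFINITION ONLY: `BarlowAdhesionR` is the byte-identical copy (same namespace) of §2 of the registered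
skeleton `HOME/cf-p1/route/lines/tex/TexShadow.lean` (v8.3/v8.4: «Vocabulary of the line still local: `BarlowAdhesionR` only»), so that the TB-1 files of
`stub_textureBuild` (TB-0.md: `CellCover`, crust cells, the tiling identity) can name it under `Theorems/` and a later skeleton version imports it instead of
declaring it.  Nothing is claimed about it (it is the registered stub `stub_barlowAdhesionR`, owner K1 / wulff-p1); rung F-C1 not moved.
-/

noncomputable section

open scoped BigOperators InnerProductSpace ENNReal
open MeasureTheory Filter

namespace Summit.Ventures.Crystal3D.Cruxes.TextureLiminf.TexShadow

open Summit.Ventures.Crystal3D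
open Literature.MathematicalPhysics.StatisticalMechanics (IsHaggSeq contactDeficiency)

/-- **One-plate adhesion for every Barlow substrate, CONTINUATION FORM** (v5 repair of v4's
`BarlowAdhesion`, false as typed for loose hcp/dhcp terminations — cf-p2 R30-0): a finite packing `X`
containing the clamped plate `P` = the stacking's slab `-2R ≤ ⟪p, ν⟫ ≤ -R` of radius `ρ` gains from it at
most the rest's own deficiency, plus the best gain of a finite piece `Q` of the substrate's OWN continuation
beyond the inner face, plus `Cρ`:  `#cross(P, X∖P) ≤ D(X∖P) + (#cross(P, Q) − D(Q)) + Cρ`.  (`Q = ∅`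
recovers the v4 form, which therefore follows whenever continuation gains are `≤ Cρ` — every fcc face, every
tight Barlow face; the route crux `NoReconstructionGain` is the fcc instance modulo that lattice count.) -/
def BarlowAdhesionR : Prop :=
  ∃ R C : ℝ, 1 ≤ R ∧ ∀ σ : ℤ → ℤ, IsHaggSeq σ → ∀ (L : E3 ≃ₗᵢ[ℝ] E3) (s ν : E3), ‖ν‖ = 1 →
    ∀ ρ : ℝ, R ≤ ρ → ∀ X P : Finset E3,
    (∀ p ∈ X, ∀ q ∈ X, p ≠ q → 1 ≤ dist p q) → P ⊆ X →
    (∀ p, p ∈ P ↔ (p ∈ stacking L s σ ∧ -(2 * R) ≤ ⟪p, ν⟫_ℝ ∧ ⟪p, ν⟫_ℝ ≤ -R ∧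
        ‖p‖ ^ 2 - ⟪p, ν⟫_ℝ ^ 2 ≤ ρ ^ 2)) →
    ∃ Q : Finset E3, (↑Q : Set E3) ⊆ stacking L s σ ∧ (∀ q ∈ Q, -R < ⟪q, ν⟫_ℝ) ∧
      ((((P ×ˢ (X \ P)).filter fun pq => dist pq.1 pq.2 = 1).card : ℕ) : ℝ) ≤
        contactDeficiency (X \ P) +
          (((((P ×ˢ Q).filter fun pq => dist pq.1 pq.2 = 1).card : ℕ) : ℝ) - contactDeficiency Q) +
          C * ρ

/-- The `Q = ∅` (v4, continuation-free) form implies the continuation form. -/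
theorem barlowAdhesionR_of_noContinuation
    (h : ∃ R C : ℝ, 1 ≤ R ∧ ∀ σ : ℤ → ℤ, IsHaggSeq σ → ∀ (L : E3 ≃ₗᵢ[ℝ] E3) (s ν : E3), ‖ν‖ = 1 →
      ∀ ρ : ℝ, R ≤ ρ → ∀ X P : Finset E3,
      (∀ p ∈ X, ∀ q ∈ X, p ≠ q → 1 ≤ dist p q) → P ⊆ X →
      (∀ p, p ∈ P ↔ (p ∈ stacking L s σ ∧ -(2 * R) ≤ ⟪p, ν⟫_ℝ ∧ ⟪p, ν⟫_ℝ ≤ -R ∧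
          ‖p‖ ^ 2 - ⟪p, ν⟫_ℝ ^ 2 ≤ ρ ^ 2)) →
      ((((P ×ˢ (X \ P)).filter fun pq => dist pq.1 pq.2 = 1).card : ℕ) : ℝ) ≤ contactDeficiency (X \ P) + C * ρ) :
    BarlowAdhesionR := by
  obtain ⟨R, C, hR, hA⟩ := h
  refine ⟨R, C, hR, fun σ hσ L s ν hν ρ hρ X P hX hP hPiff => ⟨∅, by simp, by simp, ?_⟩⟩
  have h0 : contactDeficiency (∅ : Finset E3) = 0 := by
    simp [contactDeficiency]
  simpa [h0] using hA σ hσ L s ν hν ρ hρ X P hX hP hPiff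

end Summit.Ventures.Crystal3D.Cruxes.TextureLiminf.TexShadow

end
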